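import Literature.NumberTheory.EllipticCurves.QuadraticTwistSelmerInfty
import Literature.NumberTheory.EllipticCurves.SelmerPInftyRestriction
import Literature.NumberTheory.EllipticCurves.SelmerRestrictionCorank
import Literature.NumberTheory.EllipticCurves.SelmerCorankAssembly
import Literature.NumberTheory.EllipticCurves.PeriodIndexCorestrictionLocal
import Literature.NumberTheory.EllipticCurves.SubgroupSelmerCocycleCriteriaProofs
import Literature.NumberTheory.EllipticCurves.Sprung2012.SharpFlatSelmer
import Summits.BirchSwinnertonDyer.BirchSwinnertonDyer.Theorems.GenusKolyvaginAtTwoEquivariantKolyvaginExactAtTwoTwistInfRes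
import HarnessLib

/-!
# Route `ByReductionTypeAtTwo` (rung K4), crux `SupersingularRankZeroAtTwo` (item stmt-BirchSwinnertonDyer-19097), hand hK87-C
# (-imc's K87-C `BlindZeroOfTwistSelmerCorankAtTwo`), steps (S2)(S3)(S4, Galois side): **the `v`-STRICT Selmer classes of
# the quadratic twist `E^{(d)}` restrict INJECTIVELY into Sprung's `Sel•(E/K_∞)`, onto `χ_θ`-eigenclasses of `conj`**
# (cell `bsd-2adic`, seat `bsd-2adic-t42` GEN 46; `--supports 19097`, helper)

HONEST FRAMING (D-0036/D-0054): THEOREMS ONLY (no definition, no named fact, no `sorry`, no instance); generic over the number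
field `K`, the prime `p`, the `ℤ_p`-extension `κ` (any normal `H ≤ Γ_K` fixing `θ = √d` where possible), the place datum
`(E, ap, g, c)` and the chroma `col`. Nothing about any curve is asserted; 19097 OPEN; BSD proved for no curve.

For a Weierstrass curve `W/K`, `d ∈ K^×`, `θ = √d ∈ K̄`, and a normal subgroup `H ≤ Γ_K` FIXING `θ` (inside a
`ℤ_p`-extension: `K(√d) ⊆ K_∞`, i.e. `p = 2` in practice), let `Ψ = twistH1Equiv : H¹(H, E^{(d)}[p^∞]) ≃ H¹(H, E[p^∞])` be
the tree's twist isomorphism (`QuadraticTwistSelmer`, Greenberg LNM 1716 §4 p. 107) and `res : H¹(K, ·) → H¹(H, ·)` the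
restriction (`resSubgroupH1`). For a class `s ∈ H¹(K, E^{(d)}[p^∞])`:
* §1 **STRICT at `E` ⟹ the •-condition at the place of `K̄^H` singled out by `closureEmb E`, for EVERY set of
  functionals** (`twistH1Equiv_resSubgroupH1_mem_sharpFlatLocalKummerOverOfEmb`): if `res_E s = 0` in `H¹(E, E^{(d)}[p^∞])`
  (`resPrimary … E p s = 0`), the cocycle of `Ψ(res s)` restricted to `Γ_E ∩ H` is the coboundary of the TORSION point
  `Q = e_E(n)` (the local twist isomorphism applied to the local coboundary point), so the witness `(Q, k)` with
  `p^k Q = 0 ∈ M` and `z(p^k Q) = z(0) = 0` puts it in `sharpFlatLocalKummerOverOfEmb W p H (closureEmb E) M 𝒦`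
  — -imc's «strict at the place over `2` ⟹ •, via the witness `Q = 0`» (here `Q` torsion, `p^k Q = 0`).
* §2 `Ψ(res s) ∈ Sel_{p^∞}(E/K̄^H)` for `s ∈ Sel_{p^∞}(E^{(d)}/K)` (tree `resSubgroupH1_mem_selmerGroupOver`,
  `QuadraticTwistSelmer.mem_selmerGroupOver_iff_twist`); `conj_σ Ψ(res s) = χ_θ(σ) Ψ(res s)`
  (`twistH1Equiv_conjH1`, `conjH1_resSubgroupH1_eq`); hence for `H = ker κ`:
  **`s ∈ Sel_{p^∞}(E^{(d)}/K)` strict at `E` ⟹ `Ψ(res s) ∈ Sel•(E/K_∞)`** for every `(ap, g, c, col)`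
  (`twistH1Equiv_resSubgroupH1_mem_sharpFlatSelmerInfty`), an eigenclass of `conj_γ` with eigenvalue `χ_θ(γ)`.
* §3 injectivity of `s ↦ Ψ(res s)` when `E(K̄)[p^∞]^{H} = 0` (inflation–restriction, tree
  `GenusExact.TwistInfRes.resSubgroupH1_injective_of_fixedPoints_eq_bot` + `fixedPoints_eq_bot_of_equivariant_equiv`), and the
  finite form used by the hand: **the anti-invariants `Sel• ∩ ker(conj_γ + 1)` finite, `χ_θ(γ) = −1`, `E[p^∞]^{ker κ} = 0` ⟹ the
  `E`-strict part `Sel_{p^∞}(E^{(d)}/K) ∩ ker res_E` is finite** (`finite_strictSelmer_twist_of_finite_antiInvariants`).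

References: [GreenbergLNM1716] §3 (restriction), §4 p. 107 («`A_s = A` as `G_{F_∞}`-modules»); [Sprung2012] Def. 7.9/7.11;
[SerreGaloisCohomology1997] I §2.4, §2.6; [SilvermanAEC2009] X.2 Prop. 2.4, X.5 Cor. 5.4.
-/

set_option autoImplicit false
-- the Theorems namespace of this sub repeats the summit name by design (D-0017 nested layout)
set_option linter.dupNamespace false

noncomputable section

open scoped Classical

-- `K : Type` (universe `0`): the tree's `resSubgroupH1_mem_selmerGroupOver` and `finite_torsionBy_selmerGroupPInfty` are
-- stated in universe `0`; the hand's consumer is `K = ℚ`.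

namespace Summit.BirchSwinnertonDyer.BirchSwinnertonDyer.Theorems

namespace BlindPinch

open WeierstrassCurve Literature.NumberTheory.EllipticCurves Literature.NumberTheory.EllipticCurves.Sprung2012
  Literature.NumberTheory.EllipticCurves.Sprung2017 Literature.NumberTheory.GaloisRepresentations
  Literature.NumberTheory.EllipticCurves.QuadraticTwistSelmer Literature.NumberTheory.EllipticCurves.CoeffTwist
  NumberField IsDedekindDomain ZpExtension

variable {K : Type} [Field K] [NumberField K] (W : WeierstrassCurve K) {C : VariableChange K}
  (hC : C • W = W.quadraticTwist 1) {d : K} (hd : d ≠ 0) {θ : AlgebraicClosure K}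
  (hθ : θ ^ 2 = algebraMap K (AlgebraicClosure K) d) (p : ℕ) [hp : Fact p.Prime]
  (H : Subgroup (Field.absoluteGaloisGroup K)) [H.Normal]
  (hH : ∀ σ : Field.absoluteGaloisGroup K, σ ∈ H → σ • θ = θ)

/-! ## §1 Strict at `E` ⟹ the •-condition (witness: a torsion point) -/

section Strict

variable (E : Type) [Field E] [Algebra K E]

omit [H.Normal] in
/-- **A class of `H¹(K, E^{(d)}[p^∞])` that is STRICT at `E` (vanishes in `H¹(E, E^{(d)}[p^∞])`) restricts, after the
twist isomorphism `Ψ`, into Sprung's •-condition at the place singled out by `closureEmb E`, for EVERY subgroup `M` of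
local points and EVERY set `𝒦` of functionals**: the restricted cocycle is the Kummer cocycle `τ ↦ τQ − Q` of the
TORSION point `Q = e_E(n)` (`n` the local coboundary point of `s`, `e_E` the local twist isomorphism at
`θ_E = closureEmb θ`), and with `p^k Q = 0` the divisibility clause reads `p^k ∣ z(0) = 0`.
[cite: Sprung2012, Def. 7.9 (p. 1503)] [cite: GreenbergLNM1716, §4 p. 107] -/
theorem twistH1Equiv_resSubgroupH1_mem_sharpFlatLocalKummerOverOfEmb {s : galH1Primary (W.quadraticTwist d) p}
    (hs : resPrimary (W.quadraticTwist d) E p s = 0) (M : AddSubgroup (localPoints W E)) (𝒦 : Set (M →+ ℤ_[p])) :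
    twistH1Equiv W hC hd hθ p H hH (resSubgroupH1 H (geomPrimaryTorsion (W.quadraticTwist d) p) s) ∈
      sharpFlatLocalKummerOverOfEmb W p H (closureEmb (K := K) E) M 𝒦 := by
  obtain ⟨z, rfl⟩ := oneCocycleClass_surjective _ s
  -- the local coboundary point of the strict class
  have hs' := (CocycleCriteria.resH1Hom_oneCocycleClass_eq_zero_iff (resGal (K := K) E)
    (primaryBaseChangeMap (W.quadraticTwist d) E p) (primaryBaseChangeMap_smul (W.quadraticTwist d) E p) z).mp hs
  obtain ⟨n', hn'⟩ := hs'
  set n : localPoints (W.quadraticTwist d) E :=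
    (localPointsEquivGeomPoints (W.quadraticTwist d) E).symm (n' : geomPoints ((W.quadraticTwist d).baseChange E)) with hn
  have hcob : ∀ x : Field.absoluteGaloisGroup E,
      pointsMap (W.quadraticTwist d) E ((z.1 (resGal (K := K) E x) : geomPrimaryTorsion (W.quadraticTwist d) p) :
        geomPoints (W.quadraticTwist d)) = x • n - n := by
    intro x
    have h := congrArg (fun t : geomPrimaryTorsion ((W.quadraticTwist d).baseChange E) p ↦
      (localPointsEquivGeomPoints (W.quadraticTwist d) E).symm (t : geomPoints ((W.quadraticTwist d).baseChange E))) (hn' x)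
    simp only [coe_primaryBaseChangeMap, AddEquiv.symm_apply_apply, AddSubgroupClass.coe_sub,
      primaryComponent.coe_smul, map_sub] at h
    rw [h, hn, symm_equivariant (localPointsEquivGeomPoints (W.quadraticTwist d) E)
      (localPointsEquivGeomPoints_smul (W.quadraticTwist d) E)]
  -- `Q = e_E(n)` is torsion
  have hθE := closureEmb_sqrt_sq hθ E
  set Q : localPoints W E := twistLocalPointsEquiv W hC hd E hθE n with hQ
  obtain ⟨k, hk'⟩ := AddCommGroup.mem_primaryComponent.mp n'.2
  have hkn : p ^ k • n = 0 := by
    rw [hn, ← map_nsmul, hk', map_zero]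
  have hkQ : p ^ k • Q = 0 := by rw [hQ, ← map_nsmul, hkn, map_zero]
  have hQM : p ^ k • Q ∈ M := by rw [hkQ]; exact M.zero_mem
  -- the cocycle of `Ψ(res [z])`
  rw [resSubgroupH1_oneCocycleClass, twistH1Equiv, coeffH1Equiv_eq_subgroupH1Congr]
  change h1Equiv _ _ (oneCocycleClass _ (resCocycle H z)) ∈ _
  rw [h1Equiv_apply, resH1Hom_oneCocycleClass]
  refine ⟨_, Q, k, hQM, rfl, fun w _ ↦ ?_, fun τ ↦ ?_⟩
  · have h0 : (⟨p ^ k • Q, hQM⟩ : M) = 0 := Subtype.ext hkQ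
    rw [h0, map_zero]; exact dvd_zero _
  · rw [pullback_resHomOfEquivariant_apply, resCocycle_apply]
    change pointsMapOfEmb W (closureEmb (K := K) E)
      ((primaryComponentCongr (twistGeomPointsEquiv W hC hd hθ) p
        (z.1 (resGal (K := K) E (τ : Field.absoluteGaloisGroup E))) : geomPrimaryTorsion W p) : geomPoints W) = _
    rw [coe_primaryComponentCongr, pointsMapOfEmb_twistGeomPointsEquiv W hC hd hθ (closureEmb (K := K) E) hθE rfl]
    change twistLocalPointsEquiv W hC hd E hθE (pointsMap (W.quadraticTwist d) E _) = _
    rw [hcob, map_sub, twistLocalPointsEquiv_smul_of_eq W hC hd hθE _ (smul_closureEmb_sqrt_of_mem H hH E _ τ.2)]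

end Strict

/-! ## §2 Selmer classes and the sign rule -/

section Selmer

omit hp in
/-- **`Ψ(res s) ∈ Sel_{p^∞}(E/K̄^H)` for `s ∈ Sel_{p^∞}(E^{(d)}/K)`** (restriction preserves the Selmer conditions,
`resSubgroupH1_mem_selmerGroupOver`; the twist isomorphism carries `Sel(E^{(d)}/K̄^H)` onto `Sel(E/K̄^H)`,
`mem_selmerGroupOver_iff_twist`). [cite: GreenbergLNM1716, §4 p. 107] [cite: DokchitserDokchitserAnnals2010, Lemma 4.14 (proof)] -/
theorem twistH1Equiv_resSubgroupH1_mem_selmerGroupOver {s : galH1Primary (W.quadraticTwist d) p}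
    (hs : s ∈ selmerGroupPInfty (W.quadraticTwist d) p) :
    twistH1Equiv W hC hd hθ p H hH (resSubgroupH1 H (geomPrimaryTorsion (W.quadraticTwist d) p) s) ∈
      W.selmerGroupOver p H := by
  have h : resSubgroupH1 H (geomPrimaryTorsion (W.quadraticTwist d) p) s ∈ (W.quadraticTwist d).selmerGroupOver p H :=
    (W.quadraticTwist d).resSubgroupH1_mem_selmerGroupOver p H hs
  exact (mem_selmerGroupOver_iff_twist W hC hd hθ p H hH
    (resSubgroupH1 H (geomPrimaryTorsion (W.quadraticTwist d) p) s)).mp h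

omit hp in
/-- **The sign rule on restricted classes: `conj_σ Ψ(res s) = χ_θ(σ) · Ψ(res s)`** (`conj_σ` fixes restricted classes,
and `conj_σ Ψ = χ_θ(σ) Ψ conj_σ`). [cite: GreenbergLNM1716, §4 p. 107] [cite: SerreLocalFields1979, VII §5 Prop. 3] -/
theorem conjH1_twistH1Equiv_resSubgroupH1 (σ : Field.absoluteGaloisGroup K) (s : galH1Primary (W.quadraticTwist d) p) :
    W.conjH1 p H σ (twistH1Equiv W hC hd hθ p H hH (resSubgroupH1 H (geomPrimaryTorsion (W.quadraticTwist d) p) s)) =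
      quadraticSign θ σ •
        twistH1Equiv W hC hd hθ p H hH (resSubgroupH1 H (geomPrimaryTorsion (W.quadraticTwist d) p) s) := by
  change W.conjH1 p H σ (coeffH1Equiv p H _ _ _ _ _) = quadraticSign θ σ • coeffH1Equiv p H _ _ _ _ _
  rw [conjH1_coeffH1Equiv p H _ _ _ _ (quadraticSign_eq_one_or θ) σ, conjH1_resSubgroupH1_eq]

variable (κ : ZpExtension K p) (hker : ∀ σ : Field.absoluteGaloisGroup K, σ ∈ κ.kerSubgroup → σ • θ = θ)
  (E : Type) [Field E] [Algebra K E] (ap : ℤ) (g : Field.absoluteGaloisGroup E) (c : ℕ → localPoints W E) (col : Chroma)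

/-- **A STRICT-at-`E` Selmer class of the twist restricts into Sprung's `Sel•(E/K_∞)`, for EVERY chroma and EVERY local
datum `(ap, g, c)`** (`√d ∈ K_∞`): it is Selmer over `K_∞` (§2), and every conjugate `conj_σ Ψ(res s) = ±Ψ(res s)` lies
in the •-condition at the place singled out by `closureEmb E` (§1; the •-condition is a subgroup). -imc's (S3): «the image
lies in `Sel^{col}(E/ℚ_∞)`: at the place over `2` the classes are loc₂-trivial ⟹ in the •-condition for EVERY chroma …;
the •-condition at all `conj_σ`-translates». [cite: Sprung2012, Def. 7.11 (p. 1503)] [cite: GreenbergLNM1716, §4 p. 107] -/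
theorem twistH1Equiv_resSubgroupH1_mem_sharpFlatSelmerInfty {s : galH1Primary (W.quadraticTwist d) p}
    (hsel : s ∈ selmerGroupPInfty (W.quadraticTwist d) p) (hstrict : resPrimary (W.quadraticTwist d) E p s = 0) :
    twistH1Equiv W hC hd hθ p κ.kerSubgroup hker
        (resSubgroupH1 κ.kerSubgroup (geomPrimaryTorsion (W.quadraticTwist d) p) s) ∈
      sharpFlatSelmerInfty W κ (closureEmb (K := K) E) ap g c col := by
  rw [mem_sharpFlatSelmerInfty_iff]
  refine ⟨twistH1Equiv_resSubgroupH1_mem_selmerGroupOver W hC hd hθ p κ.kerSubgroup hker hsel, fun σ ↦ ?_⟩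
  have hmem := twistH1Equiv_resSubgroupH1_mem_sharpFlatLocalKummerOverOfEmb W hC hd hθ p κ.kerSubgroup hker E hstrict
    (localTowerPointsOfEmb κ (closureEmb (K := K) E) W) (colemanKer κ (closureEmb (K := K) E) W ap g c col)
  rw [conjH1_twistH1Equiv_resSubgroupH1]
  rcases quadraticSign_eq_one_or θ σ with h1 | h1
  · rw [h1, one_zsmul]; exact hmem
  · rw [h1, neg_one_zsmul]; exact neg_mem hmem

end Selmer

/-! ## §3 Injectivity, and the finite form used by the hand -/

section Finite

variable (κ : ZpExtension K p) (hker : ∀ σ : Field.absoluteGaloisGroup K, σ ∈ κ.kerSubgroup → σ • θ = θ)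

include hC hd hθ hker in
/-- `E^{(d)}[p^∞]^{ker κ} = 0` when `E[p^∞]^{ker κ} = 0` (the twist isomorphism is `ker κ`-equivariant).
[cite: GreenbergLNM1716, §4 p. 107] -/
theorem fixedPoints_kerSubgroup_quadraticTwist_eq_bot
    (hfix : FixedPoints.addSubgroup κ.kerSubgroup (geomPrimaryTorsion W p) = ⊥) :
    FixedPoints.addSubgroup κ.kerSubgroup (geomPrimaryTorsion (W.quadraticTwist d) p) = ⊥ :=
  GenusExact.TwistInfRes.fixedPoints_eq_bot_of_equivariant_equiv (N := κ.kerSubgroup)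
    (primaryComponentCongr (twistGeomPointsEquiv W hC hd hθ) p)
    (primaryComponentCongr_smul_subgroup p κ.kerSubgroup (twistGeomPointsEquiv W hC hd hθ) (quadraticSign θ)
      (twistGeomPointsEquiv_smul_quadraticSign hd hθ W hC) (quadraticSign_of_mem κ.kerSubgroup hker)) hfix

/-- **`s ↦ Ψ(res s)` is injective on `H¹(K, E^{(d)}[p^∞])` when `E[p^∞]^{ker κ} = 0`** (inflation–restriction).
[cite: SerreGaloisCohomology1997, I §2.6] [cite: GreenbergLNM1716, §3 Lemma 3.1] -/
theorem twistH1Equiv_resSubgroupH1_injective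
    (hfix : FixedPoints.addSubgroup κ.kerSubgroup (geomPrimaryTorsion W p) = ⊥) :
    Function.Injective (fun s : galH1Primary (W.quadraticTwist d) p ↦
      twistH1Equiv W hC hd hθ p κ.kerSubgroup hker
        (resSubgroupH1 κ.kerSubgroup (geomPrimaryTorsion (W.quadraticTwist d) p) s)) :=
  (twistH1Equiv W hC hd hθ p κ.kerSubgroup hker).injective.comp
    (GenusExact.TwistInfRes.resSubgroupH1_injective_of_fixedPoints_eq_bot κ.kerSubgroup
      (continuous_smul_geomPrimaryTorsion (W.quadraticTwist d) p)
      (fixedPoints_kerSubgroup_quadraticTwist_eq_bot W hC hd hθ p κ hker hfix))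

variable (E : Type) [Field E] [Algebra K E] (ap : ℤ) (g : Field.absoluteGaloisGroup E) (c : ℕ → localPoints W E)
  (col : Chroma)

include hC hd hθ hker in
/-- **The finite form (hand hK87-C): if the `conj_γ`-anti-invariants of `Sel•(E/K_∞)` are finite, `χ_θ(γ) = −1` and
`E[p^∞]^{ker κ} = 0`, then the `E`-strict part `Sel_{p^∞}(E^{(d)}/K) ∩ ker res_E` is finite** — it injects into the
anti-invariants by `s ↦ Ψ(res s)` (§§1–3). [cite: GreenbergLNM1716, §3, §4 p. 107] [cite: Sprung2012, Def. 7.11] -/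
theorem finite_strictSelmer_twist_of_finite_antiInvariants {γ : Field.absoluteGaloisGroup K}
    (hγ : quadraticSign θ γ = -1) (hfix : FixedPoints.addSubgroup κ.kerSubgroup (geomPrimaryTorsion W p) = ⊥)
    (hfin : Finite ↥(sharpFlatSelmerInfty W κ (closureEmb (K := K) E) ap g c col ⊓
      (W.conjH1 p κ.kerSubgroup γ + AddMonoidHom.id (W.subgroupH1 p κ.kerSubgroup)).ker)) :
    Finite ↥(selmerGroupPInfty (W.quadraticTwist d) p ⊓ (resPrimary (W.quadraticTwist d) E p).ker) := by
  haveI := hfin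
  refine Finite.of_injective
    (fun s : ↥(selmerGroupPInfty (W.quadraticTwist d) p ⊓ (resPrimary (W.quadraticTwist d) E p).ker) ↦
      (⟨twistH1Equiv W hC hd hθ p κ.kerSubgroup hker
          (resSubgroupH1 κ.kerSubgroup (geomPrimaryTorsion (W.quadraticTwist d) p) s),
        AddSubgroup.mem_inf.mpr ⟨?_, ?_⟩⟩ :
        ↥(sharpFlatSelmerInfty W κ (closureEmb (K := K) E) ap g c col ⊓
          (W.conjH1 p κ.kerSubgroup γ + AddMonoidHom.id (W.subgroupH1 p κ.kerSubgroup)).ker))) ?_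
  · exact twistH1Equiv_resSubgroupH1_mem_sharpFlatSelmerInfty W hC hd hθ p κ hker E ap g c col
      (AddSubgroup.mem_inf.mp s.2).1 ((AddMonoidHom.mem_ker).mp (AddSubgroup.mem_inf.mp s.2).2)
  · rw [AddMonoidHom.mem_ker, AddMonoidHom.add_apply, AddMonoidHom.id_apply, conjH1_twistH1Equiv_resSubgroupH1, hγ,
      neg_one_zsmul, neg_add_cancel]
  · intro s s' h
    exact Subtype.ext (twistH1Equiv_resSubgroupH1_injective W hC hd hθ p κ hker hfix (congrArg Subtype.val h))

end Finite

end BlindPinch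

end Summit.BirchSwinnertonDyer.BirchSwinnertonDyer.Theorems

end
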